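import Literature.NumberTheory.EllipticCurves.HeegnerGeomTransversalProofs
import Literature.NumberTheory.EllipticCurves.HeegnerTraceRelationSplitProofs
import Literature.NumberTheory.EllipticCurves.HeegnerPointsOfConductorOneRationalityProofs
import Literature.NumberTheory.EllipticCurves.HeegnerPointsShimuraReciprocityHoldsProofs
import Literature.NumberTheory.EllipticCurves.ModularParametrizationDegree
import HarnessLib

/-!
# The BOTTOM distribution relation of the principal Heegner system in `E(K̄)` at a split prime:
# `Tr_{K[p]/K[1]} P[p] = a_p · P[1] − P′ − P″` (Gross 1991, Prop. 3.7 (ii); Darmon 2004, Prop. 3.10;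
# Perrin-Riou 1987, §3.1) — THEOREMS ONLY

Topic `NumberTheory/EllipticCurves`; namespace `Literature.NumberTheory.EllipticCurves`. No definition,
no named fact. Cell `pub/bsd-print-x9`, LEAD `bsd-line-x9-p1` (envelope infrastructure, part V-a).

The vertical relations of `HeegnerGeomPrincipalSystemProofs` / `HeegnerGeomTowerRecurrenceProofs`
(`Tr_{K[p^{e+2}]/K[p^{e+1}]} P[p^{e+2}] = a_p P[p^{e+1}] − P[p^e]`) start at `K[p]/K[1]`-level `e + 1 ≥ 1`.
The bottom step `K[p]/K[1]` at a prime `p` SPLIT in `K` has a different shape (Gross 1991, Prop. 3.7 (ii):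
"`Tr_{K_ℓ/K_1} y_ℓ = (a_ℓ − σ_λ − σ_λ^{-1}) y_1`"; Darmon 2004, (3.10)–(3.11): `a_ℓ P_n = P⁽⁰⁾ + P⁽∞⁾ + Trace P_{nℓ}`):
two Heegner points OF CONDUCTOR `1` are subtracted. The tree proves this on complex points with the two
subtracted points identified as `φ(τ_{Q₁})`, `φ(τ_{Q₂})` for Heegner forms `Q₁, Q₂` of discriminant `d_K`
and residue `β` (`HeegnerTraceSplit.finsum_mem_ringClassGalOver_eq_frobeniusTrace_smul_sub_sub`; their
identification with `σ_λ^{±1} P[1]` is Shimura reciprocity, not used here). This file transports it to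
the currency of `HeegnerFamily` / `StabilizedHeegnerData` — points of `E(K̄)` with the `Γ_K`-action and
transversal sums:

* §1 `exists_geomPoint_of_mem_heegnerForms` — every Heegner point `φ(τ_Q)` of conductor `1`
  (`Q` a level-`N` Heegner form of discriminant `d_K`) lifts to `x ∈ E(K̄)` fixed by `Gal(K̄/K[1])`
  (rationality over `H_K = K[1]`: the tree's theorem `phi_heegnerTau_mem_range_map_singularModuliField_holds`
  and `ringClassField_one`).
* §2 `exists_sum_transversal_smul_eq_frobeniusTrace_smul_sub_sub` — for `x₀, x₁ ∈ E(K̄)` over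
  `φ(x(1))`, `φ(x(p))` (`x₁` read in `E(K[p])`) and ANY transversal `S` of `Gal(K̄/K[p])` in `Gal(K̄/K[1])`:
  `∑_{s ∈ S} s • x₁ = a_p • x₀ − x₀′ − x₀″` with `x₀′, x₀″` Heegner points of conductor `1` and residue `β`
  (`IsHeegnerGeomPoint … 1`) fixed by `Gal(K̄/K[1])`.

## References

* [GrossLMS1991] B. H. Gross, *Kolyvagin's work on modular elliptic curves*, LMS LNS 153 (1991), §3,
  Prop. 3.7 (ii) and its proof (PDF pp. 217–218).
* [Darmon2004] H. Darmon, *Rational Points on Modular Elliptic Curves*, CBMS 101 (2004), Prop. 3.10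
  (p. 35) and its proof, eqs. (3.10)–(3.11) (p. 36).
* [PerrinRiou1987BSMF] B. Perrin-Riou, Bull. SMF 115 (1987), §3.1 (relations de distribution), §3.3.
* [Cox2013] D. A. Cox, *Primes of the form x² + ny²*, 2nd ed. (2013), Thm. 11.1, Cor. 11.34.
-/

noncomputable section

open scoped Classical

namespace Literature.NumberTheory.EllipticCurves

open WeierstrassCurve RingClassField ModularForms

variable {K : Type} [Field K] [NumberField K]

/-! ### §1 Heegner points of conductor `1` in `E(K̄)` -/

/-- **Every Heegner point of conductor `1` lifts to `E(K̄)`, fixed by `Gal(K̄/K[1])`** (Darmon 2004,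
Thm. 3.6: `Φ_N(τ) ∈ E(H)`; Gross 1991, §1: "`x_1` is rational over `K_1`"; Cox Thm. 11.1 / Cor. 11.34:
`H = K(j(𝒪_K)) = K[1]`): for `K` imaginary quadratic, `Q` a level-`N` Heegner form of discriminant `d_K`
and `jbar : K̄ → ℂ`, there is `x ∈ E(K̄)` with `x_ℂ = φ(τ_Q)` and `σ • x = x` for `σ ∈ Gal(K̄/K[1])`.
[cite: Darmon2004, Thm. 3.6 (PDF pp. 43–44)] [cite: GrossLMS1991, §1] [cite: Cox2013, Thm. 11.1 and Cor. 11.34] -/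
theorem exists_geomPoint_of_mem_heegnerForms {N : ℕ} [NeZero N] {W : WeierstrassCurve ℚ} [W.IsElliptic]
    (hK : IsImaginaryQuadratic K) (Dt : ModularParametrizationData W N)
    (jbar : AlgebraicClosure K →+* ℂ) {Q : ℤ × ℤ × ℤ}
    (hQ : Q ∈ heegnerForms N (NumberField.discr K)) :
    ∃ x : WeierstrassCurve.geomPoints (W.baseChange K),
      complexPoint W jbar x = Dt.φ (heegnerTau Q) ∧
        ∀ σ ∈ ringClassSubgroup K 1 jbar, σ • x = x := by
  set Kbar := AlgebraicClosure K
  set ι : K →+* ℂ := jbar.comp (algebraMap K Kbar) with hι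
  -- (1) rationality over `H_K = K[1] ⊂ ℂ`
  obtain ⟨P, hP⟩ := phi_heegnerTau_mem_range_map_singularModuliField_holds N W K hK Dt ι hQ
  have hbc : (W.baseChange K).map (Algebra.ofId K Kbar : K →+* Kbar) = W.baseChange Kbar :=
    W.map_baseChange (Algebra.ofId K Kbar)
  have hmem : ∀ u : singularModuliField K ι, (u : ℂ) ∈ ringClassField K ι 1 := fun u ↦ by
    rw [ringClassField_one]; exact u.2
  -- (2) transfer to `E(K̄)`
  rcases hPc : P with _ | ⟨u, v, huv⟩
  · refine ⟨0, ?_, fun σ _ ↦ smul_zero σ⟩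
    rw [map_zero, ← hP, hPc]
    exact (map_zero _).symm
  · obtain ⟨a, ha⟩ := mem_range_of_mem_ringClassField hK jbar one_ne_zero (hmem u)
    obtain ⟨b, hb⟩ := mem_range_of_mem_ringClassField hK jbar one_ne_zero (hmem v)
    have huvC : (W.baseChange ℂ).toAffine.Nonsingular (u : ℂ) (v : ℂ) :=
      (WeierstrassCurve.Affine.baseChange_nonsingular W
        (f := (singularModuliField K ι).subtype.toRatAlgHom) (singularModuliField K ι).subtype.injective
        u v).mpr huv
    have hab : (W.baseChange Kbar).toAffine.Nonsingular a b := by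
      rw [← WeierstrassCurve.Affine.baseChange_nonsingular W (f := jbar.toRatAlgHom) jbar.injective a b]
      simpa [ha, hb] using huvC
    have hab' : ((W.baseChange K).map (Algebra.ofId K Kbar : K →+* Kbar)).toAffine.Nonsingular a b := by
      rw [hbc]; exact hab
    refine ⟨.some a b hab', ?_, fun σ hσ ↦ ?_⟩
    · have h1 : complexPoint W jbar (.some a b hab') =
          WeierstrassCurve.Affine.Point.map jbar.toRatAlgHom
            (WeierstrassCurve.Affine.Point.congrEquiv hbc (.some a b hab')) := rfl
      rw [h1, WeierstrassCurve.Affine.Point.congrEquiv_some hbc hab',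
        WeierstrassCurve.Affine.Point.map_some, ← hP, hPc, WeierstrassCurve.Affine.Point.map_some]
      simp only [RingHom.toRatAlgHom_apply, Subfield.coe_subtype, ha, hb]
    · have hσa : σ • a = a :=
        smul_eq_self_of_mem_ringClassSubgroup hK jbar one_ne_zero hσ (by rw [ha]; exact hmem u)
      have hσb : σ • b = b :=
        smul_eq_self_of_mem_ringClassSubgroup hK jbar one_ne_zero hσ (by rw [hb]; exact hmem v)
      rw [Field.absoluteGaloisGroup.smul_def] at hσa hσb
      change WeierstrassCurve.Affine.Point.map
        ((Field.absoluteGaloisGroup.toAlgEquiv K σ : Kbar ≃ₐ[K] Kbar) : Kbar →ₐ[K] Kbar)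
        (.some a b hab') = .some a b hab'
      rw [WeierstrassCurve.Affine.Point.map_some]
      simp only [AlgEquiv.coe_toAlgHom, hσa, hσb]

/-! ### §2 The bottom relation over a transversal -/

/-- **`Tr_{K[p]/K[1]} P[p] = a_p · P[1] − P′ − P″` IN `E(K̄)`, over ANY transversal, at a SPLIT prime**
(Gross 1991, Prop. 3.7 (ii); Darmon 2004, Prop. 3.10, eqs. (3.10)–(3.11); Perrin-Riou 1987, §3.1). For
`E = W/ℚ` globally minimal at its own level `N = N_E`, `K` imaginary quadratic with the Heegner hypothesis and
`d_K < −4` (`𝒪_K^× = {±1}`), `4N ∣ β² − d_K`, a good prime `p ∤ N` split in `K`, points `x₀, x₁ ∈ E(K̄)` over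
the principal Heegner points `φ(x(1))`, `φ(x(p))` (`x₁` read in `E(K[p])` through `P₁`) and any finite
transversal `S` of `Gal(K̄/K[p])` in `Gal(K̄/K[1])`: there are Heegner points `x₀′, x₀″ ∈ E(K̄)` of conductor
`1` and residue `β`, fixed by `Gal(K̄/K[1])`, with **`∑_{s ∈ S} s • x₁ = a_p • x₀ − x₀′ − x₀″`**,
`a_p = W.frobeniusTrace p`. (In print `x₀′, x₀″ = σ_𝔭^{±1} x₀` by Shimura reciprocity — not asserted.)
[cite: GrossLMS1991, §3 Prop. 3.7 (ii) (proof, PDF pp. 217–218)]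
[cite: Darmon2004, Prop. 3.10 (p. 35) and proof eqs. (3.10)–(3.11) (p. 36)]
[cite: PerrinRiou1987BSMF, §3.1 (relations de distribution)] -/
theorem exists_sum_transversal_smul_eq_frobeniusTrace_smul_sub_sub {W : WeierstrassCurve ℚ}
    [W.IsElliptic] [W.IsGloballyMinimal] [NeZero (W.conductorNorm ℤ)] (hK : IsImaginaryQuadratic K)
    (hH : SatisfiesHeegnerHypothesis (W.conductorNorm ℤ) K)
    (Dt : ModularParametrizationData W (W.conductorNorm ℤ)) {β : ℤ}
    (hβ : (4 * (W.conductorNorm ℤ : ℕ) : ℤ) ∣ β ^ 2 - NumberField.discr K)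
    (jbar : AlgebraicClosure K →+* ℂ) {p : ℕ} (hp : p.Prime)
    (hsplit : ((Ideal.span {(p : ℤ)}).primesOver (NumberField.RingOfIntegers K)).ncard = 2)
    (hpN : ¬ p ∣ W.conductorNorm ℤ) (hdK : NumberField.discr K < -4)
    {x₀ x₁ : WeierstrassCurve.geomPoints (W.baseChange K)}
    (hx₀ : complexPoint W jbar x₀ = heegnerPointComplexOfConductor Dt (NumberField.discr K) β 1)
    {P₁ : (W.baseChange (ringClassField K (jbar.comp (algebraMap K (AlgebraicClosure K))) p)).toAffine.Point}
    (hx₁ : complexPoint W jbar x₁ = WeierstrassCurve.Affine.Point.map (W' := W)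
      (ringClassField K (jbar.comp (algebraMap K (AlgebraicClosure K))) p).subtype.toRatAlgHom P₁)
    (hP₁ : WeierstrassCurve.Affine.Point.map (W' := W)
      (ringClassField K (jbar.comp (algebraMap K (AlgebraicClosure K))) p).subtype.toRatAlgHom P₁ =
      heegnerPointComplexOfConductor Dt (NumberField.discr K) β p)
    {S : Finset (Field.absoluteGaloisGroup K)} (hSsub : ∀ s ∈ S, s ∈ ringClassSubgroup K 1 jbar)
    (htrans : ∀ τ ∈ ringClassSubgroup K 1 jbar,
      ∃! s, s ∈ S ∧ s⁻¹ * τ ∈ ringClassSubgroup K p jbar) :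
    ∃ x₀' x₀'' : WeierstrassCurve.geomPoints (W.baseChange K),
      IsHeegnerGeomPoint (W.conductorNorm ℤ) W K Dt β 1 jbar x₀' ∧
      IsHeegnerGeomPoint (W.conductorNorm ℤ) W K Dt β 1 jbar x₀'' ∧
      (∀ σ ∈ ringClassSubgroup K 1 jbar, σ • x₀' = x₀') ∧
      (∀ σ ∈ ringClassSubgroup K 1 jbar, σ • x₀'' = x₀'') ∧
      ∑ s ∈ S, s • x₁ = (W.frobeniusTrace p) • x₀ - x₀' - x₀'' := by
  -- the transversal sum is the Galois trace in `E(K[p])`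
  obtain ⟨G, hG, hsum⟩ := exists_finset_ringClassGalOver_complexPoint_sum_smul_eq W hK jbar
    one_ne_zero hp.ne_zero (one_dvd p) hx₁ hSsub htrans
  -- the split trace relation for the principal point of conductor `p`
  obtain ⟨Q₁, Q₂, hQ₁, hQ₂, hres₁, hres₂, -, -, key⟩ :=
    HeegnerTraceSplit.finsum_mem_ringClassGalOver_eq_frobeniusTrace_smul_sub_sub hK
      (jbar.comp (algebraMap K (AlgebraicClosure K))) Dt hH hβ hp hsplit hpN hp.not_dvd_one one_ne_zero
      (Nat.coprime_one_right _) (Or.inr hdK) (mul_one p) hP₁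
  have hQ₁' : Q₁ ∈ heegnerForms (W.conductorNorm ℤ) (NumberField.discr K) := by
    simpa using hQ₁
  have hQ₂' : Q₂ ∈ heegnerForms (W.conductorNorm ℤ) (NumberField.discr K) := by
    simpa using hQ₂
  obtain ⟨x₀', hx₀', hfix'⟩ := exists_geomPoint_of_mem_heegnerForms hK Dt jbar hQ₁'
  obtain ⟨x₀'', hx₀'', hfix''⟩ := exists_geomPoint_of_mem_heegnerForms hK Dt jbar hQ₂'
  have hgeom' : IsHeegnerGeomPoint (W.conductorNorm ℤ) W K Dt β 1 jbar x₀' :=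
    ⟨Q₁, by rwa [mul_comm] at hQ₁, hres₁, hx₀'⟩
  have hgeom'' : IsHeegnerGeomPoint (W.conductorNorm ℤ) W K Dt β 1 jbar x₀'' :=
    ⟨Q₂, by rwa [mul_comm] at hQ₂, hres₂, hx₀''⟩
  refine ⟨x₀', x₀'', hgeom', hgeom'', hfix', hfix'', ?_⟩
  -- rewrite the `∑ᶠ` over `Gal(K[p]/K[1])` as the sum over `G`
  have hGset : (ringClassGalOver (jbar.comp (algebraMap K (AlgebraicClosure K))) p 1 :
      Set (ringClassField K (jbar.comp (algebraMap K (AlgebraicClosure K))) p ≃ₐ[ℚ]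
        ringClassField K (jbar.comp (algebraMap K (AlgebraicClosure K))) p)) = ↑G := by
    ext g
    rw [SetLike.mem_coe, Finset.mem_coe, hG]
  rw [hGset, finsum_mem_coe_finset, ← map_sum] at key
  -- compare complex points and conclude by injectivity
  apply complexPoint_injective W jbar
  rw [hsum, key, map_sub, map_sub, map_zsmul, hx₀, hx₀', hx₀'']

/-! ### §3 `Gal(K̄/K[c])` is normal in `Γ_K` -/

/-- **`Gal(K̄/K[c]) ⊴ Γ_K`** (`K[c]/K` is Galois — indeed generalised dihedral over `ℚ`, abelian over `K`;
Cox Thm. 11.1 / §9.A: the ring class field is an abelian extension of `K`): seen inside `ℂ`, every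
automorphism of `ℂ` over `ι(K)` maps `K[c]` onto itself (`ringEquiv_apply_mem_ringClassField_iff`), so the
conjugate of an element of `Γ_K` acting trivially on `K[c]` acts trivially on `K[c]`.
[cite: Cox2013, Thm. 11.1 and Lemma 9.3 (K[c]/K abelian, L/ℚ generalised dihedral)] -/
theorem ringClassSubgroup_normal (hK : IsImaginaryQuadratic K) (jbar : AlgebraicClosure K →+* ℂ)
    {c : ℕ} (hc : c ≠ 0) : (ringClassSubgroup K c jbar).Normal := by
  refine ⟨fun n hn g ↦ ?_⟩
  set ι : K →+* ℂ := jbar.comp (algebraMap K (AlgebraicClosure K)) with hι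
  obtain ⟨gC, hgC⟩ := exists_ringEquiv_apply_eq_smul jbar g
  obtain ⟨nC, hnC⟩ := exists_ringEquiv_apply_eq_smul jbar n
  have hsymm : ∀ a : AlgebraicClosure K, gC.symm (jbar a) = jbar (g⁻¹ • a) := fun a ↦ by
    apply gC.injective
    rw [RingEquiv.apply_symm_apply, hgC, smul_inv_smul]
  have hσC : ∀ a : AlgebraicClosure K,
      (gC.symm.trans (nC.trans gC)) (jbar a) = jbar ((g * n * g⁻¹) • a) := fun a ↦ by
    simp only [RingEquiv.coe_trans, Function.comp_apply, hsymm, hnC, hgC, mul_smul]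
  refine mem_ringClassSubgroup_of_ringEquiv_apply_eq_self hσC fun x hx ↦ ?_
  have hgK : ∀ k : K, gC (ι k) = ι k := fun k ↦ by
    show gC (jbar (algebraMap K (AlgebraicClosure K) k)) = jbar (algebraMap K (AlgebraicClosure K) k)
    rw [hgC, Field.absoluteGaloisGroup.smul_def, AlgEquiv.commutes]
  have hx' : gC.symm x ∈ ringClassField K ι c :=
    (ringEquiv_apply_mem_ringClassField_iff hK ι hc hgK (gC.symm x)).mp
      (by rwa [RingEquiv.apply_symm_apply])
  show gC (nC (gC.symm x)) = x
  rw [ringEquiv_apply_eq_self_of_mem_ringClassSubgroup hK hc hn hnC hx', RingEquiv.apply_symm_apply]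

/-! ### §4 All Heegner points of conductor `1` and one orientation are `Γ_K`-conjugate -/

/-- **Shimura reciprocity, transitivity form, in `E(K̄)`** (Darmon 2004, Thm. 3.7: "`Φ_N(α ⋆ τ) = rec(α⁻¹) Φ_N(τ)`"
with `Pic(𝒪_K)` acting simply transitively on the Heegner points `(𝒪_K, 𝔫, [𝔞])`; Gross 1984 §I.1 /
Gross 1991 §3): for `K` imaginary quadratic with the Heegner hypothesis, two level-`N` Heegner forms `Q, Q'`
of discriminant `d_K` with the SAME residue `β (mod 2N)`, and `x, x' ∈ E(K̄)` over `φ(τ_Q)`, `φ(τ_{Q'})`: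
**`x' = τ • x` for some `τ ∈ Γ_K`**. From the tree's theorem `heegnerPoints_shimuraReciprocity_holds`
(the family `P_q ∈ E(H_K)` on representatives and the transitive `Gal(H_K/K)`-action), the `Γ₀(N)`-invariance of
`φ` (`φ_gamma0_smul_holds'`), extension of `Gal(H_K/K)` to `Aut(ℂ/K)` and the `jbar`-dictionary.
[cite: Darmon2004, Thm. 3.7 (Shimura reciprocity, PDF p. 44)] [cite: Gross1984, §I.1 and §4 (4.2)]
[cite: GrossLMS1991, §3 (Gal(K_1/K) permutes the x_1)] -/
theorem exists_smul_eq_of_mem_heegnerForms {N : ℕ} [NeZero N] {W : WeierstrassCurve ℚ} [W.IsElliptic]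
    (hK : IsImaginaryQuadratic K) (hH : SatisfiesHeegnerHypothesis N K)
    (Dt : ModularParametrizationData W N) (jbar : AlgebraicClosure K →+* ℂ) {β : ℤ}
    (hβ : (4 * N : ℤ) ∣ β ^ 2 - NumberField.discr K) {Q Q' : ℤ × ℤ × ℤ}
    (hQ : Q ∈ heegnerForms N (NumberField.discr K)) (hQβ : Q.2.1 ≡ β [ZMOD 2 * N])
    (hQ' : Q' ∈ heegnerForms N (NumberField.discr K)) (hQ'β : Q'.2.1 ≡ β [ZMOD 2 * N])
    {x x' : WeierstrassCurve.geomPoints (W.baseChange K)}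
    (hx : complexPoint W jbar x = Dt.φ (heegnerTau Q)) (hx' : complexPoint W jbar x' = Dt.φ (heegnerTau Q')) :
    ∃ τ : Field.absoluteGaloisGroup K, τ • x = x' := by
  set Kbar := AlgebraicClosure K
  set ι : K →+* ℂ := jbar.comp (algebraMap K Kbar) with hι
  set F := singularModuliField K ι with hF
  -- a Heegner datum with residue `β`; representatives of `Q`, `Q'`
  obtain ⟨H, hHβ⟩ := exists_heegnerDatum N hK.discr_neg hβ
  subst hHβ
  obtain ⟨q, hq, γ₁, hγ₁⟩ := H.exists_isGamma0Equiv Q hQ hQβ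
  obtain ⟨q', hq', γ₂, hγ₂⟩ := H.exists_isGamma0Equiv Q' hQ' hQ'β
  have hφq : Dt.φ (heegnerTau q) = Dt.φ (heegnerTau Q) := by
    rw [← hγ₁]; exact Dt.φ_gamma0_smul_holds' γ₁ (heegnerTau Q)
  have hφq' : Dt.φ (heegnerTau q') = Dt.φ (heegnerTau Q') := by
    rw [← hγ₂]; exact Dt.φ_gamma0_smul_holds' γ₂ (heegnerTau Q')
  -- Shimura reciprocity: the transitive action on the lifts `P_q ∈ E(H_K)`
  obtain ⟨P, θ, hP, hθ⟩ := heegnerPoints_shimuraReciprocity_holds N W K hK hH Dt H ι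
  set γ := heegnerFormClass hK (⟨q', hq'⟩ : H.reps) * (heegnerFormClass hK (⟨q, hq⟩ : H.reps))⁻¹
    with hγ
  obtain ⟨q'', hq''cls, hq''P⟩ := hθ γ ⟨q, hq⟩
  have hq'' : q'' = ⟨q', hq'⟩ :=
    heegnerFormClass_injective_reps hK H (by simp only [hq''cls, hγ, inv_mul_cancel_right])
  subst hq''
  -- extend `θ γ ∈ Gal(H_K/K)` to an automorphism of `ℂ`
  letI : Algebra K ℂ := ι.toAlgebra
  obtain ⟨hfd, -⟩ := finiteDimensional_and_isGalois_singularModuliField irreducible_classPolynomial_holds hK ι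
  haveI := hfd
  haveI : FiniteDimensional ℚ F := Module.Finite.trans K F
  haveI : Algebra.IsAlgebraic ℚ F := Algebra.IsAlgebraic.of_finite ℚ _
  have hcard : Cardinal.mk F ≤ Cardinal.aleph0 :=
    Literature.FieldTheory.AlgClosed.Subfield.cardinalMk_le_aleph0_of_isAlgebraic _
  obtain ⟨σC, hσC⟩ := Literature.FieldTheory.AlgClosed.Complex.exists_ringEquiv_apply_eq_of_subfield F hcard
    (F.subtype.comp (θ γ : F ≃ₐ[K] F).toAlgHom.toRingHom)
  have hσx : ∀ z : F, σC z = ((θ γ z : F) : ℂ) := fun z ↦ by simpa using hσC z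
  have hσK : ∀ k : K, σC ((jbar.comp (algebraMap K Kbar)) k) = (jbar.comp (algebraMap K Kbar)) k := by
    intro k
    have h1 : (ι k : ℂ) = ((algebraMap K F k : F) : ℂ) := (coe_algebraMap_singularModuliField ι k).symm
    rw [← hι, h1, hσx, AlgEquiv.commutes]
  obtain ⟨τ, hτ⟩ := exists_absoluteGaloisGroup_of_ringEquiv jbar σC hσK
  refine ⟨τ, complexPoint_injective W jbar ?_⟩
  rw [complexPoint_smul_eq_map W jbar hτ x, hx, ← hφq, ← hP ⟨q, hq⟩, hx', ← hφq', ← hP ⟨q', hq'⟩, ← hq''P,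
    WeierstrassCurve.Affine.Point.map_map]
  have hR : WeierstrassCurve.Affine.Point.map (W' := W) (singularModuliField K ι).subtype.toRatAlgHom
        (WeierstrassCurve.Affine.Point.map (W' := W) ((θ γ : F ≃ₐ[K] F) : F →ₐ[K] F) (P ⟨q, hq⟩)) =
      WeierstrassCurve.Affine.Point.map (W' := W)
        ((singularModuliField K ι).subtype.toRatAlgHom.comp
          (((θ γ : F ≃ₐ[K] F) : F →ₐ[K] F).restrictScalars ℚ)) (P ⟨q, hq⟩) := by
    rw [← WeierstrassCurve.Affine.Point.map_map]
    congr 1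
  rw [hR]
  exact WeierstrassCurve.Affine.Point.map_congr_fun (fun z ↦ by simp [hσx z]) _

/-! ### §5 The norm to `K` of a Heegner point of conductor `1` does not depend on the point -/

/-- **`Norm_{K[1]/K} x′ = Norm_{K[1]/K} x` for any two Heegner points `x, x′ ∈ E(K̄)` of conductor `1` and the
same orientation** — in particular for the two subtracted points of the bottom relation
(`exists_sum_transversal_smul_eq_frobeniusTrace_smul_sub_sub`) against the principal point: over ANY left
transversal `T` of `Gal(K̄/K[1])` in `Γ_K`, `∑_{t ∈ T} t • x′ = ∑_{t ∈ T} t • x`. (Print: `x′ = σ x` for some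
`σ ∈ Gal(K̄/K)` by Shimura reciprocity, and the trace to `K` is `σ`-invariant; here:
`exists_smul_eq_of_mem_heegnerForms`, normality of `Gal(K̄/K[1])` and transversal-independence of the sum.)
Gross 1991, §1: "`y_K = Tr_{K_1/K}(y_1)` … obtained by adding `y_1` to its conjugates".
[cite: GrossLMS1991, §1 (y_K = Tr_{K_1/K} y_1) and §3 Prop. 3.7 (ii)] [cite: Darmon2004, Thm. 3.7 and §3.7 (P_K)] -/
theorem sum_smul_eq_sum_smul_of_isHeegnerGeomPoint_one {N : ℕ} [NeZero N] {W : WeierstrassCurve ℚ}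
    [W.IsElliptic] (hK : IsImaginaryQuadratic K) (hH : SatisfiesHeegnerHypothesis N K)
    (Dt : ModularParametrizationData W N) (jbar : AlgebraicClosure K →+* ℂ) {β : ℤ}
    (hβ : (4 * N : ℤ) ∣ β ^ 2 - NumberField.discr K)
    {x x' : WeierstrassCurve.geomPoints (W.baseChange K)} (hx : IsHeegnerGeomPoint N W K Dt β 1 jbar x)
    (hx' : IsHeegnerGeomPoint N W K Dt β 1 jbar x')
    (hfix : ∀ σ ∈ ringClassSubgroup K 1 jbar, σ • x = x)
    {T : Finset (Field.absoluteGaloisGroup K)}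
    (htT : ∀ τ : Field.absoluteGaloisGroup K, ∃! t, t ∈ T ∧ t⁻¹ * τ ∈ ringClassSubgroup K 1 jbar) :
    ∑ t ∈ T, t • x' = ∑ t ∈ T, t • x := by
  obtain ⟨Q, hQ, hQβ, hxQ⟩ := hx
  obtain ⟨Q', hQ', hQ'β, hxQ'⟩ := hx'
  simp only [Nat.cast_one, one_pow, mul_one, one_mul] at hQ hQ' hQβ hQ'β
  obtain ⟨τ₀, hτ₀⟩ := exists_smul_eq_of_mem_heegnerForms hK hH Dt jbar hβ hQ hQβ hQ' hQ'β hxQ hxQ'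
  haveI := ringClassSubgroup_normal hK jbar (c := 1) one_ne_zero
  set Hc := ringClassSubgroup K 1 jbar with hHc
  -- the translated transversal `T τ₀`
  have hinj : Set.InjOn (fun t ↦ t * τ₀) ↑T := fun a _ b _ h ↦ mul_right_cancel h
  have htT' : ∀ τ ∈ (⊤ : Subgroup (Field.absoluteGaloisGroup K)),
      ∃! r, r ∈ T.image (fun t ↦ t * τ₀) ∧ r⁻¹ * τ ∈ Hc := by
    intro τ _
    obtain ⟨t, ⟨htT₀, ht⟩, huniq⟩ := htT (τ * τ₀⁻¹)
    refine ⟨t * τ₀, ⟨Finset.mem_image_of_mem _ htT₀, ?_⟩, ?_⟩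
    · have h := Subgroup.Normal.conj_mem inferInstance _ ht τ₀⁻¹
      simpa only [mul_inv_rev, inv_inv, mul_assoc, inv_mul_cancel, mul_one] using h
    · rintro r ⟨hr, hr'⟩
      obtain ⟨t', ht'T, rfl⟩ := Finset.mem_image.mp hr
      have ht'' : t'⁻¹ * (τ * τ₀⁻¹) ∈ Hc := by
        have h := Subgroup.Normal.conj_mem inferInstance _ hr' τ₀
        simpa only [mul_inv_rev, mul_assoc, mul_inv_cancel_left] using h
      rw [huniq t' ⟨ht'T, ht''⟩]
  have htT₀ : ∀ τ ∈ (⊤ : Subgroup (Field.absoluteGaloisGroup K)), ∃! t, t ∈ T ∧ t⁻¹ * τ ∈ Hc :=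
    fun τ _ ↦ htT τ
  calc ∑ t ∈ T, t • x' = ∑ t ∈ T, (t * τ₀) • x := by
        refine Finset.sum_congr rfl fun t _ ↦ ?_
        rw [← hτ₀, mul_smul]
    _ = ∑ r ∈ T.image (fun t ↦ t * τ₀), r • x := by rw [Finset.sum_image hinj]
    _ = ∑ t ∈ T, t • x :=
        sum_smul_eq_of_transversal (L := ⊤) (H := Hc) (fun _ _ ↦ Subgroup.mem_top _)
          (fun _ _ ↦ Subgroup.mem_top _) htT' htT₀ hfix

end Literature.NumberTheory.EllipticCurves

end
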